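import Summits.Ventures.PercRepro.GenQFlatLatticeB
import Summits.Ventures.PercRepro.GenQFlatLatticeE
import Summits.Ventures.PercRepro.GenQFlatLatticeN
import Summits.Ventures.PercRepro.GenQFlatLatticeQ
import Summits.Ventures.PercRepro.GenQFlatRows
import Summits.Ventures.PercRepro.GenQHyperplaneRowsB

/-!
# PercRepro — the flat-lattice counting rows, part R: (G-B) and (G-C) at `q = 6` in the certificate vocabulary
(night-4, gen 13)

The trace-layer certificates of the `(9, 7)` cell (`TraceSumsCore 6` at `t = 6`, coranks `9 … 14`, the two-level
profile LP on the Lean-backed rows) quote the rows (G-B) and (G-C) with the flats by rank as the LP's atoms: the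
lines `Nl`, the planes `NR 3`, the solids `N4`, and the hyperplanes `hypTr 5`.  Part B's `gb_row` and part E's
`gc_row` carry the ranks `0 … 4` as `hypTr ρ` and, in (G-C), the truncated binomial `C(s, k + s − n)` (`= 1` for
`s < n − k`, where the true count is `0`).  This file restates both at `q = 6` exactly as the LP uses them:

* `gb_row_six`: `Σ_s C(s, j)·h_s ≤ Σ_s SP_{s,j} + Σ_s C(n−s, 3)·C(s, j)·Nl s + Σ_s C(n−s, 2)·C(s, j)·NR 3 s
  + Σ_s C(n−s, 1)·C(s, j)·N4 s` (`2 ≤ j`; the flats of rank `≤ 1` of a simple matroid carry no `j`-subset);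
* `gc_row_six`: `C(n, k) ≤ Σ_m #Pc (n−k) m + gA_k + Σ_{s ≥ n−k} C(s, k + s − n)·(h_s + Nl s + NR 3 s + N4 s)`
  for `k ≤ n − 6` — the `k`-subsets with a non-spanning complement contain `G ∖ F` for a flat `F` with a
  spanning trace of `s ≥ n − k` points (`card_powersetCard_superset_eq_zero` below `n − k`), and the `k`-subsets
  of rank `6` are the `Pc`-classes of level `n − k` (part A).

`NR_two_eq_Nl` identifies the rank-`2` flat count with the line count of record.  Imports `GenQFlatLatticeB`,
`GenQFlatLatticeE`, `GenQFlatLatticeN`, `GenQFlatLatticeQ`, `GenQFlatRows`, `GenQHyperplaneRowsB`.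
-/
namespace PercRepro.Night4

open Finset ThmH SixFour GenQ PerFlat Star

variable {α : Type*} [DecidableEq α] {M : Matroid α} [M.Finite]

/-- The rank-`2` flats with `s` points of `G` are the lines with `s` points of `G`. -/
theorem NR_two_eq_Nl (G : Finset α) (s : ℕ) : NR M G 2 s = Nl M G s := by
  unfold NR Nl
  rw [flatsQ_two]

/-- The flats of rank `≤ 1` of a simple matroid carry no trace of `≥ 2` points. -/
theorem hypTr_eq_zero_of_le_one (hs : Simple M) (G : Finset α) {ρ s : ℕ} (hρ : ρ ≤ 1) (hs2 : 2 ≤ s) :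
    hypTr M G ρ s = 0 := by
  refine Nat.eq_zero_of_le_zero ((hypTr_le_NR G ρ s).trans (le_of_eq ?_))
  exact NR_eq_zero_of_flats_le (fun K hK => card_le_one_of_flatsQ_le_one hs hρ hK) G (by omega)

/-- **(G-B) at `q = 6` in the certificate vocabulary** (`2 ≤ j`, simple `M`): the `j`-subsets of the hyperplane
traces are of rank `5` or lie in a line / plane / solid, through which at most `C(n − s, 3)` / `C(n − s, 2)` /
`C(n − s, 1)` hyperplanes with spanning traces pass. -/
theorem gb_row_six (hs : Simple M) {G : Finset α} (hG : G ⊆ gr M) {j : ℕ} (hj : 2 ≤ j) :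
    ∑ s ∈ Finset.range (G.card + 1), s.choose j * hypTr M G 5 s
      ≤ ∑ s ∈ Finset.range (G.card + 1), spSum M G 5 s j
        + ∑ s ∈ Finset.range (G.card + 1), (G.card - s).choose 3 * (s.choose j * Nl M G s)
        + ∑ s ∈ Finset.range (G.card + 1), (G.card - s).choose 2 * (s.choose j * NR M G 3 s)
        + ∑ s ∈ Finset.range (G.card + 1), (G.card - s).choose 1 * (s.choose j * N4 M G s) := by
  have h := gb_row (M := M) (q := 6) hG (by norm_num) j
  have e5 : Finset.range (6 - 1) = {0, 1, 2, 3, 4} := by decide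
  rw [e5, Finset.sum_insert (by decide), Finset.sum_insert (by decide), Finset.sum_insert (by decide),
    Finset.sum_insert (by decide), Finset.sum_singleton] at h
  simp only [Nat.reduceSub] at h
  refine h.trans ?_
  -- ranks `0` and `1` carry nothing; ranks `2`, `3`, `4` are bounded by the lines, planes, solids
  have h0 : ∀ ρ, ρ ≤ 1 → ∑ s ∈ Finset.range (G.card + 1),
      (G.card - s).choose (5 - ρ) * (s.choose j * hypTr M G ρ s) = 0 := by
    intro ρ hρ
    refine Finset.sum_eq_zero (fun s _ => ?_)
    rcases Nat.lt_or_ge s 2 with hlt | hge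
    · rw [Nat.choose_eq_zero_of_lt (by omega : s < j), zero_mul, mul_zero]
    · rw [hypTr_eq_zero_of_le_one hs G hρ hge, mul_zero, mul_zero]
  have h2 : ∑ s ∈ Finset.range (G.card + 1), (G.card - s).choose 3 * (s.choose j * hypTr M G 2 s)
      ≤ ∑ s ∈ Finset.range (G.card + 1), (G.card - s).choose 3 * (s.choose j * Nl M G s) :=
    Finset.sum_le_sum (fun s _ => Nat.mul_le_mul_left _ (Nat.mul_le_mul_left _
      ((hypTr_le_NR G 2 s).trans (le_of_eq (NR_two_eq_Nl G s)))))
  have h3 : ∑ s ∈ Finset.range (G.card + 1), (G.card - s).choose 2 * (s.choose j * hypTr M G 3 s)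
      ≤ ∑ s ∈ Finset.range (G.card + 1), (G.card - s).choose 2 * (s.choose j * NR M G 3 s) :=
    Finset.sum_le_sum (fun s _ => Nat.mul_le_mul_left _ (Nat.mul_le_mul_left _ (hypTr_le_NR G 3 s)))
  have h4 : ∑ s ∈ Finset.range (G.card + 1), (G.card - s).choose 1 * (s.choose j * hypTr M G 4 s)
      ≤ ∑ s ∈ Finset.range (G.card + 1), (G.card - s).choose 1 * (s.choose j * N4 M G s) :=
    Finset.sum_le_sum (fun s _ => Nat.mul_le_mul_left _ (Nat.mul_le_mul_left _
      ((hypTr_le_NR G 4 s).trans (le_of_eq (NR_four G s)))))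
  have h00 := h0 0 (by norm_num)
  have h01 := h0 1 (by norm_num)
  simp only [Nat.reduceSub] at h00 h01
  omega

/-- No `k`-subset of `G` contains `G ∖ F` when `k + |F ∩ G| < n`. -/
theorem card_powersetCard_superset_eq_zero (G F : Finset α) {k : ℕ} (hlt : k + (F ∩ G).card < G.card) :
    ((G.powersetCard k).filter (fun A : Finset α => G \ F ⊆ A)).card = 0 := by
  rw [Finset.card_eq_zero, Finset.filter_eq_empty_iff]
  intro A hA hsub
  rw [Finset.mem_powersetCard] at hA
  have h1 := Finset.card_le_card hsub
  rw [Finset.card_sdiff, hA.2] at h1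
  omega

/-- **The sharp cover of the non-spanning complements**: the `k`-subsets `A` of `G` with `G ∖ A` non-spanning
number at most `Σ_{ρ < q} Σ_{s ≥ n − k} C(s, k + s − n)·h^{(ρ)}_s`. -/
theorem card_nonspanning_compl_le_sharp {G : Finset α} {q : ℕ} (hG : G ⊆ gr M)
    (hrG : M.eRk (G : Set α) = (q : ℕ∞)) (k : ℕ) :
    ((G.powersetCard k).filter (fun A : Finset α => G \ A ∉ Rq M G q)).card
      ≤ ∑ ρ ∈ Finset.range q, ∑ s ∈ Finset.Icc (G.card - k) G.card,
          s.choose (k + s - G.card) * hypTr M G ρ s := by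
  classical
  -- the cover by the flats `cl(G ∖ A)` (part E)
  have hcover : (G.powersetCard k).filter (fun A : Finset α => G \ A ∉ Rq M G q)
      ⊆ (Finset.range q).biUnion (fun ρ => (Finset.range (G.card + 1)).biUnion (fun s =>
          (flatsTr M G ρ s).biUnion (fun F => (G.powersetCard k).filter (fun A : Finset α => G \ F ⊆ A)))) := by
    intro A hA
    rw [Finset.mem_filter, Finset.mem_powersetCard] at hA
    obtain ⟨⟨hAG, hAk⟩, hns⟩ := hA
    obtain ⟨ρ, hρ⟩ := exists_eRk_eq_nat (M := M) (G \ A)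
    have hρq : ρ < q := by
      have hle : M.eRk ((G \ A : Finset α) : Set α) ≤ (q : ℕ∞) := by
        rw [← hrG]
        exact M.eRk_mono (Finset.coe_subset.2 Finset.sdiff_subset)
      rw [hρ] at hle
      have h1 : ρ ≤ q := by exact_mod_cast hle
      rcases Nat.lt_or_ge ρ q with h | h
      · exact h
      · exfalso
        have hρq' : ρ = q := le_antisymm h1 h
        apply hns
        rw [mem_Rq]
        exact ⟨Finset.sdiff_subset, by rw [hρ, hρq']⟩
    have hF := clF_mem_flatsTr hG (Finset.sdiff_subset (s := G) (t := A)) hρ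
    simp only [Finset.mem_biUnion, Finset.mem_range]
    refine ⟨ρ, hρq, (clF M (G \ A) ∩ G).card,
      Nat.lt_succ_of_le (Finset.card_le_card Finset.inter_subset_right), clF M (G \ A), hF, ?_⟩
    rw [Finset.mem_filter, Finset.mem_powersetCard]
    refine ⟨⟨hAG, hAk⟩, ?_⟩
    intro y hy
    rw [Finset.mem_sdiff] at hy
    by_contra hyA
    apply hy.2
    rw [mem_clF]
    refine M.subset_closure _ ?_ ?_
    · rw [← coe_gr M]
      exact Finset.coe_subset.2 (Finset.sdiff_subset.trans hG)
    · rw [Finset.mem_coe, Finset.mem_sdiff]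
      exact ⟨hy.1, hyA⟩
  refine (Finset.card_le_card hcover).trans ?_
  refine Finset.card_biUnion_le.trans (Finset.sum_le_sum (fun ρ _ => ?_))
  -- per rank: the sizes below `n − k` contribute nothing
  have hIcc : Finset.Icc (G.card - k) G.card = (Finset.range (G.card + 1)).filter (fun s => G.card ≤ k + s) := by
    ext s
    simp only [Finset.mem_Icc, Finset.mem_filter, Finset.mem_range]
    omega
  rw [hIcc, Finset.sum_filter]
  refine Finset.card_biUnion_le.trans (Finset.sum_le_sum (fun s _ => ?_))
  refine Finset.card_biUnion_le.trans ?_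
  unfold hypTr
  split_ifs with hks
  · rw [Finset.card_eq_sum_ones (flatsTr M G ρ s), Finset.mul_sum, mul_one]
    refine Finset.sum_le_sum (fun F hF => ?_)
    have hs : (F ∩ G).card = s := (mem_flatsTr.1 hF).2.1
    have h := card_powersetCard_superset_le G F k
    rw [hs] at h
    exact h
  · refine le_of_eq (Finset.sum_eq_zero (fun F hF => ?_))
    have hs : (F ∩ G).card = s := (mem_flatsTr.1 hF).2.1
    exact card_powersetCard_superset_eq_zero G F (by omega)

/-- **(G-C) at `q = 6` in the certificate vocabulary** (`k ≤ n − 6`, simple `M`):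
`C(n, k) ≤ Σ_m #Pc (n−k) m + gA_k + Σ_{s ≥ n−k} C(s, k + s − n)·(h_s + Nl s + NR 3 s + N4 s)`. -/
theorem gc_row_six (hs : Simple M) {G : Finset α} (hG : G ⊆ gr M)
    (hrG : M.eRk (G : Set α) = ((6 : ℕ) : ℕ∞)) {k : ℕ} (hkn : k + 6 ≤ G.card) :
    G.card.choose k ≤ ∑ m ∈ Finset.Icc (mTr M G) 6, (Pc M G 6 (G.card - k) m).card + gA M G 6 6 k
      + ∑ s ∈ Finset.Icc (G.card - k) G.card,
          s.choose (k + s - G.card) * (hypTr M G 5 s + Nl M G s + NR M G 3 s + N4 M G s) := by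
  classical
  -- `C(n, k) = #{rank ≤ 5} + #{rank 6}`
  have hsplit := Finset.card_filter_add_card_filter_not
    (s := G.powersetCard k) (p := fun A : Finset α => M.eRk (A : Set α) + 1 ≤ ((6 : ℕ) : ℕ∞))
  rw [Finset.card_powersetCard, card_rank_ge_self_eq hrG, card_rank_q_subsets_eq_sum_Pc hG hrG (by omega)]
    at hsplit
  -- `#{rank ≤ 5} ≤ gA + #{non-spanning complement}`
  have hgA : ((G.powersetCard k).filter (fun A : Finset α => M.eRk (A : Set α) + 1 ≤ ((6 : ℕ) : ℕ∞))).card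
      ≤ gA M G 6 6 k + ((G.powersetCard k).filter (fun A : Finset α => G \ A ∉ Rq M G 6)).card := by
    unfold gA
    rw [← Finset.card_union_of_disjoint]
    · refine Finset.card_le_card (fun A hA => ?_)
      rw [Finset.mem_filter] at hA
      rw [Finset.mem_union, Finset.mem_filter, Finset.mem_filter]
      by_cases hR : G \ A ∈ Rq M G 6
      · exact Or.inl ⟨hA.1, hA.2, hR⟩
      · exact Or.inr ⟨hA.1, hR⟩
    · rw [Finset.disjoint_left]
      intro A hA hA'
      rw [Finset.mem_filter] at hA hA'
      exact hA'.2 hA.2.2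
  have hcov := card_nonspanning_compl_le_sharp (q := 6) hG hrG k
  -- the ranks `0 … 5` of the cover, as the LP's atoms
  have hranks : ∑ ρ ∈ Finset.range 6, ∑ s ∈ Finset.Icc (G.card - k) G.card,
        s.choose (k + s - G.card) * hypTr M G ρ s
      ≤ ∑ s ∈ Finset.Icc (G.card - k) G.card,
          s.choose (k + s - G.card) * (hypTr M G 5 s + Nl M G s + NR M G 3 s + N4 M G s) := by
    simp only [Finset.sum_range_succ, Finset.sum_range_zero, zero_add]
    have hz : ∀ ρ, ρ ≤ 1 → ∑ s ∈ Finset.Icc (G.card - k) G.card, s.choose (k + s - G.card) * hypTr M G ρ s = 0 := by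
      intro ρ hρ
      refine Finset.sum_eq_zero (fun s hs' => ?_)
      rw [Finset.mem_Icc] at hs'
      rw [hypTr_eq_zero_of_le_one hs G hρ (by omega), mul_zero]
    rw [hz 0 (by norm_num), hz 1 (by norm_num), zero_add, zero_add]
    rw [← Finset.sum_add_distrib, ← Finset.sum_add_distrib, ← Finset.sum_add_distrib]
    refine Finset.sum_le_sum (fun s _ => ?_)
    have e2 := (hypTr_le_NR (M := M) G 2 s).trans (le_of_eq (NR_two_eq_Nl G s))
    have e3 := hypTr_le_NR (M := M) G 3 s
    have e4 := (hypTr_le_NR (M := M) G 4 s).trans (le_of_eq (NR_four G s))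
    nlinarith [Nat.zero_le (s.choose (k + s - G.card)), Nat.mul_le_mul_left (s.choose (k + s - G.card)) e2,
      Nat.mul_le_mul_left (s.choose (k + s - G.card)) e3, Nat.mul_le_mul_left (s.choose (k + s - G.card)) e4]
  omega

end PercRepro.Night4
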